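import Summits.Ventures.HSemireg.WedgeWeilPairs
import Summits.Ventures.HSemireg.WedgeKunnethKernel

/-!
# Venture HSemireg — KERNELS ARE HOMOGENEOUS FOR THE PAIR GRADING: a form kills a transversal class (every `w_n(q)`) iff each of its PAIR-TYPE components does —
# the `ℕⁿ`-grading «how many letters from each pair» is respected by every kernel, over EVERY field (the torus of H9's `GL_n` would need an infinite field)

HONEST FRAMING. Part of the Lean index of the computation cell `pub-hsemireg` (seat p10 gen 18, Sunday typer «UNIFORM-IN-n»).
Finite-dimensional EXTERIOR ALGEBRA over a field ONLY: no variety, no cohomology theory, no sheaf, no Ext group, no semiregularity map;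
nothing here says that HC / HC_CM / HC_AV holds; no Literature fact is declared or used.  Custodian versions as in `WedgeHankelSiegelIdeal` (1/3); the dictionary (the pairs
`(x_a, y_a)` = `(∂_a, dz̄_a)`; a monomial's pair type = its multidegree in the `n` factors) is QUOTED, never asserted.

WHAT IS IN THE TREE.  w3's support calculus `Weil.Sp P` (span of the monomials `E_s` with `P s`), `proj P` (coordinate projection; `proj_add_proj_not`, `proj_mem_and`, `Sp_inf_Sp_eq_bot`,
`mul_mem_Sp`), the pair maps `pr` / `pt` and **`Weil.f_mem_Sp`: th-7's class `w_N(q)` is supported on TRANSVERSAL sets** (`Tr t`: exactly one letter from each pair); gen 13's `Kr`.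
H9/H9b (this seat) proved that every kernel is `GL_n`-stable, in particular stable under the diagonal torus — which over an INFINITE field splits it into weight spaces.  THIS FILE gives the
field-free form of that splitting (namespace `Summit.Ventures.HSemireg.Wedge.HankelPairGrading`, new):
* §153 the PAIR TYPE `ptype t : Fin N → ℕ` of a support (`c ↦ #(t ∩ pair c)`): additive on disjoint unions (`ptype_union`), `≡ 1` on transversal sets (`ptype_of_Tr`).
* §154 **`mul_mem_Sp_ptype_succ`**: a form of pure pair type `τ` times a transversal class has pure pair type `τ + 1`; hence **`proj_ptype_mul_eq_zero`**: if `θ ∧ f = 0` for a transversal `f`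
  then `(proj_{ptype = τ} θ) ∧ f = 0` for EVERY `τ` (the component and its complement land in the disjoint spans `Sp(ptype = τ+1)` / `Sp(ptype ≠ τ+1)`), and
  **`proj_ptype_mem_Kr`: `θ ∈ Kr(univ, f, k) ⇒ proj_{ptype = τ} θ ∈ Kr(univ, f, k)`** — every kernel of a transversal class, in particular **`proj_ptype_mem_Kr_w`** for `Kr(univ, w_N(q), k)`,
  is the direct sum of its pair-type components: a form kills `w_N(q)` iff each of its multihomogeneous pieces does (`proj_not_ptype_mem_Kr`, `Kr_eq_sup_inf_Sp_ptype`,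
  `inf_Sp_ptype_disjoint`).  Consistent with the atlas: `ptype` counts letters per pair regardless of `x`/`y`, so every substitution of the letters (`Φs`, `Ψs`, H1's `Sb`) preserves
  it, and every name there is spanned by pair-homogeneous forms.
NOT typed here: images (`E_s ∧ f` has pure type `ptype s + 1`, so `V(univ, f, k)` is graded as well — immediate from §154, not spelled out); anything Ext-side.  Class side only;
new names only.
-/

open Module

namespace Summit.Ventures.HSemireg.Wedge.HankelPairGrading

open Summit.Ventures.HSemireg.Wedge Summit.Ventures.HSemireg.Wedge.Kunneth Summit.Ventures.HSemireg.Wedge.Hankel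
  Summit.Ventures.HSemireg.Wedge.KunnethKernel Summit.Ventures.HSemireg.Wedge.Weil

variable (K : Type*) [Field K] {N : ℕ}

/-! ## §153. The pair type of a support -/

/-- **the PAIR TYPE of a support `t`**: `c ↦` the number of letters of `t` from the pair `c` (`0`, `1` or `2`). -/
def ptype (t : Finset (In N)) : Fin N → ℕ := fun c => (t.filter fun i => pr i = c).card

omit [Field K] in
/-- the pair type is additive on disjoint unions. -/
lemma ptype_union {s t : Finset (In N)} (h : Disjoint s t) : ptype (s ∪ t) = ptype s + ptype t := by
  funext c
  simp only [ptype, Pi.add_apply]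
  rw [Finset.filter_union, Finset.card_union_of_disjoint (Finset.disjoint_filter_filter h)]

omit [Field K] in
/-- a transversal set has exactly one letter from each pair: `ptype t ≡ 1`. -/
lemma ptype_of_Tr {t : Finset (In N)} (ht : Tr t) : ptype t = fun _ => 1 := by
  funext c
  simp only [ptype]
  rw [Finset.card_eq_one]
  by_cases hx : xJ N c ∈ t
  · refine ⟨xJ N c, Finset.ext fun i => ?_⟩
    rw [Finset.mem_filter, Finset.mem_singleton]
    constructor
    · rintro ⟨hi, hic⟩
      rcases eq_xJ_or_eq_yJ i with e | e <;> rw [hic] at e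
      · exact e
      · exfalso
        have hy : yJ N c ∉ t := by have := (ht (xJ N c)).mp hx; rwa [pt_xJ] at this
        exact hy (e ▸ hi)
    · rintro rfl; exact ⟨hx, pr_xJ c⟩
  · have hy : yJ N c ∈ t := by
      by_contra hy
      have := (ht (yJ N c)).mpr (by rwa [pt_yJ])
      exact hy this
    refine ⟨yJ N c, Finset.ext fun i => ?_⟩
    rw [Finset.mem_filter, Finset.mem_singleton]
    constructor
    · rintro ⟨hi, hic⟩
      rcases eq_xJ_or_eq_yJ i with e | e <;> rw [hic] at e
      · exact absurd (e ▸ hi) hx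
      · exact e
    · rintro rfl; exact ⟨hy, pr_yJ c⟩

/-! ## §154. Kernels respect the pair grading -/

/-- **a form of pure pair type `τ` times a TRANSVERSAL class has pure pair type `τ + 1`.** -/
theorem mul_mem_Sp_ptype_succ {τ : Fin N → ℕ} {θ f : HT K (In N)} (hθ : θ ∈ Sp K (fun s : Finset (In N) => ptype s = τ)) (hf : f ∈ Sp K (Tr (N := N))) :
    θ * f ∈ Sp K (fun u : Finset (In N) => ptype u = τ + 1) :=
  mul_mem_Sp (fun s t hd hs ht => by rw [ptype_union hd, hs, ptype_of_Tr ht]; rfl) hθ hf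

/-- … and a form with NO component of pair type `τ` times a transversal class has no component of type `τ + 1`. -/
theorem mul_mem_Sp_ptype_ne {τ : Fin N → ℕ} {θ f : HT K (In N)} (hθ : θ ∈ Sp K (fun s : Finset (In N) => ¬ ptype s = τ)) (hf : f ∈ Sp K (Tr (N := N))) :
    θ * f ∈ Sp K (fun u : Finset (In N) => ¬ ptype u = τ + 1) :=
  mul_mem_Sp (fun s t hd hs ht => by
    rw [ptype_union hd, ptype_of_Tr ht]
    intro h; apply hs; funext c; have := congrFun h c; simp only [Pi.add_apply, Pi.one_apply] at this; omega) hθ hf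

/-- th-7's class is transversal (w3's `f_mem_Sp`). -/
lemma w_mem_Sp_Tr (q : ℕ → K) : w K N N q ∈ Sp K (Tr (N := N)) :=
  Sp_mono (fun _ ht => ht.1) (f_mem_Sp K 0 q)

/-- **IF `θ ∧ f = 0` FOR A TRANSVERSAL `f`, THEN EVERY PAIR-TYPE COMPONENT OF `θ` KILLS `f`: `proj_{ptype = τ} θ ∧ f = 0`** — the component's product has pure type `τ + 1`, the rest's product
has no such component, and the two spans meet in `0`. -/
theorem proj_ptype_mul_eq_zero (τ : Fin N → ℕ) {θ f : HT K (In N)} (hf : f ∈ Sp K (Tr (N := N))) (h : θ * f = 0) :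
    proj (K := K) (fun s : Finset (In N) => ptype s = τ) θ * f = 0 := by
  classical
  have hsplit := proj_add_proj_not (K := K) (fun s : Finset (In N) => ptype s = τ) θ
  have h1 : proj (K := K) (fun s : Finset (In N) => ptype s = τ) θ * f ∈ Sp K (fun u : Finset (In N) => ptype u = τ + 1) :=
    mul_mem_Sp_ptype_succ K (proj_mem _ θ) hf
  have h2 : proj (K := K) (fun s : Finset (In N) => ¬ ptype s = τ) θ * f ∈ Sp K (fun u : Finset (In N) => ¬ ptype u = τ + 1) :=
    mul_mem_Sp_ptype_ne K (proj_mem _ θ) hf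
  have hsum : proj (K := K) (fun s : Finset (In N) => ptype s = τ) θ * f + proj (K := K) (fun s : Finset (In N) => ¬ ptype s = τ) θ * f = 0 := by
    rw [← add_mul, hsplit, h]
  have hmem : proj (K := K) (fun s : Finset (In N) => ptype s = τ) θ * f ∈
      Sp K (fun u : Finset (In N) => ptype u = τ + 1) ⊓ Sp K (fun u : Finset (In N) => ¬ ptype u = τ + 1) :=
    ⟨h1, by rw [eq_neg_of_add_eq_zero_left hsum]; exact Submodule.neg_mem _ h2⟩
  rw [Sp_inf_Sp_eq_bot (fun s hs hn => hn hs)] at hmem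
  exact (Submodule.mem_bot K).mp hmem

/-- projections preserve degree-`k` homogeneity (`Hom(univ, k)` is itself a support span). -/
lemma proj_mem_Hom (P : Finset (In N) → Prop) [DecidablePred P] {k : ℕ} {θ : HT K (In N)} (hθ : θ ∈ Hom K (In N) Finset.univ k) :
    proj (K := K) P θ ∈ Hom K (In N) Finset.univ k := by
  rw [Hom_eq_Sp] at hθ ⊢
  exact Sp_mono (fun s hs => hs.1) (proj_mem_and hθ)

/-- **EVERY KERNEL OF A TRANSVERSAL CLASS RESPECTS THE PAIR GRADING: `θ ∈ Kr(univ, f, k) ⇒ proj_{ptype = τ} θ ∈ Kr(univ, f, k)`** for every pair type `τ` (`f` transversal) — the kernel is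
the direct sum of its multihomogeneous components, over every field. -/
theorem proj_ptype_mem_Kr (τ : Fin N → ℕ) {f : HT K (In N)} (hf : f ∈ Sp K (Tr (N := N))) {k : ℕ} {θ : HT K (In N)} (hθ : θ ∈ Kr K Finset.univ f k) :
    proj (K := K) (fun s : Finset (In N) => ptype s = τ) θ ∈ Kr K Finset.univ f k := by
  classical
  rw [mem_Kr] at hθ ⊢
  exact ⟨proj_mem_Hom K _ hθ.1, proj_ptype_mul_eq_zero K τ hf hθ.2⟩

/-- **… in particular for th-7's classes: `θ ∈ Kr(univ, w_N(q), k) ⇒ proj_{ptype = τ} θ ∈ Kr(univ, w_N(q), k)`** — a form kills `w_N(q)` iff each of its pair-type components does. -/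
theorem proj_ptype_mem_Kr_w (τ : Fin N → ℕ) (q : ℕ → K) {k : ℕ} {θ : HT K (In N)} (hθ : θ ∈ Kr K Finset.univ (w K N N q) k) :
    proj (K := K) (fun s : Finset (In N) => ptype s = τ) θ ∈ Kr K Finset.univ (w K N N q) k :=
  proj_ptype_mem_Kr K τ (w_mem_Sp_Tr K q) hθ

/-- the complementary component stays in the kernel as well (so the kernel SPLITS along `ptype = τ` / `ptype ≠ τ`). -/
theorem proj_not_ptype_mem_Kr (τ : Fin N → ℕ) {f : HT K (In N)} (hf : f ∈ Sp K (Tr (N := N))) {k : ℕ} {θ : HT K (In N)} (hθ : θ ∈ Kr K Finset.univ f k) :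
    proj (K := K) (fun s : Finset (In N) => ¬ ptype s = τ) θ ∈ Kr K Finset.univ f k := by
  classical
  have e : proj (K := K) (fun s : Finset (In N) => ¬ ptype s = τ) θ = θ - proj (K := K) (fun s : Finset (In N) => ptype s = τ) θ :=
    eq_sub_of_add_eq' (proj_add_proj_not (K := K) (fun s : Finset (In N) => ptype s = τ) θ)
  rw [e]
  exact Submodule.sub_mem _ hθ (proj_ptype_mem_Kr K τ hf hθ)

/-- **THE KERNEL IS THE DIRECT SUM OF ITS PAIR-TYPE PIECE AND THE REST**: `Kr = (Kr ⊓ Sp(ptype = τ)) ⊔ (Kr ⊓ Sp(ptype ≠ τ))` and the two meet in `0`, for every `τ`. -/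
theorem Kr_eq_sup_inf_Sp_ptype (τ : Fin N → ℕ) {f : HT K (In N)} (hf : f ∈ Sp K (Tr (N := N))) (k : ℕ) :
    Kr K Finset.univ f k = Kr K Finset.univ f k ⊓ Sp K (fun s : Finset (In N) => ptype s = τ) ⊔ Kr K Finset.univ f k ⊓ Sp K (fun s : Finset (In N) => ¬ ptype s = τ) := by
  classical
  refine le_antisymm (fun θ hθ => ?_) (sup_le inf_le_left inf_le_left)
  rw [← proj_add_proj_not (K := K) (fun s : Finset (In N) => ptype s = τ) θ]
  exact Submodule.add_mem_sup ⟨proj_ptype_mem_Kr K τ hf hθ, proj_mem _ θ⟩ ⟨proj_not_ptype_mem_Kr K τ hf hθ, proj_mem _ θ⟩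

/-- the two pieces meet in `0`. -/
theorem inf_Sp_ptype_disjoint (τ : Fin N → ℕ) (W : Submodule K (HT K (In N))) :
    Disjoint (W ⊓ Sp K (fun s : Finset (In N) => ptype s = τ)) (W ⊓ Sp K (fun s : Finset (In N) => ¬ ptype s = τ)) := by
  rw [disjoint_iff]
  refine le_bot_iff.mp ?_
  calc W ⊓ Sp K (fun s : Finset (In N) => ptype s = τ) ⊓ (W ⊓ Sp K (fun s : Finset (In N) => ¬ ptype s = τ))
      ≤ Sp K (fun s : Finset (In N) => ptype s = τ) ⊓ Sp K (fun s : Finset (In N) => ¬ ptype s = τ) := inf_le_inf inf_le_right inf_le_right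
    _ = ⊥ := Sp_inf_Sp_eq_bot (fun s hs hn => hn hs)

end Summit.Ventures.HSemireg.Wedge.HankelPairGrading
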